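import Literature.Analysis.FluidPDE.SpaceTimeMomentumBalance
import Literature.Analysis.FluidPDE.CollisionalTransferFunctional
import HarnessLib

/-!
# Serre's collitons and the tested divergence-freeness of the billiard tensor on `T^d`

D. Serre's mass–momentum tensor of a hard-sphere motion (Serre 2021 §2; Serre 2024 §5 p. 1438)
is `M = Σ_p (1, v_p) ⊗ (1, v_p) dt|_{γ(p)} + Σ_coll (1/|[v]|) (0, [v]) ⊗ (0, [v]) dℓ|_{[x_q, x_p]}`
on `ℝ_t × T^d`: the particle part along the broken lines `t ↦ (t, x_p(t))`, plus, for every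
collision of a pair `(p, q)` at time `τ` with momentum exchange `[v] = v⁺(p) - v⁻(p)`, the
**colliton** — the rank-one tensor `[v] ⊗ [v] / |[v]|` spread with the length element over the
contact segment joining the two centres (`|x_p - x_q| = ε`). "Summing all these contributions
results in a (locally) Div-free tensor" (Serre 2024, p. 1438): pairing `M` with the space–time
gradient of a `C¹` test field `Ψ = (ψ₀, ψ)` supported inside the time window gives `0`.

`Literature.Analysis.FluidPDE.SpaceTimeMomentumBalance` computed the particle part:
`∫_a^b stMomentumStreaming dt = -Σ_coll ⟪ψ(τ, x_p) - ψ(τ, x_q), [v]⟫`. This file proves that each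
colliton compensates exactly one of these jumps — the fundamental theorem of calculus along the
contact segment, `[v]` being parallel to the separation vector — and assembles the tested
identity `⟨M, ∇Ψ⟩ = 0`.

* `Torus.sub_eq_integral_fderiv` — FTC along a straight segment on the torus:
  `f(x + proj w) - f(x) = ∫₀¹ Df(x + proj(s w)) w ds` for `C¹` `f`.
* `collitonKernel ε φ i j pre post` — Serre's colliton of the ordered pair `(i, j)` tested against
  the gradient of `φ : T^d → ℝ^d`: `½ (ε/|Δv_i|) ∫₀¹ ⟪Dφ(x_j + proj(s n_{ij})) Δv_i, Δv_i⟫ ds`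
  (`n_{ij}` the minimal-image separation vector, `|n_{ij}| = ε`; arc length `dℓ = ε ds`; the
  factor `½` because both orientations of the pair are summed); `collitonPairing ε ψ γ a b`, the
  sum over the collision times in `(a, b]` and the colliding ordered pairs, for a time-dependent
  field `ψ` frozen at the collision time.
* `IsHardSphereTrajectory.collitonKernel_eq` — at a collision, `collitonKernel = ½ ⟪φ(x_i) - φ(x_j), Δv_i⟫`;
  `IsHardSphereTrajectory.sum_collidingPairs_collitonKernel` — summed over the two orientations
  it is the jump `collisionJump (momentumObservable φ) γ τ`.
* **`IsHardSphereTrajectory.integral_stMomentumStreaming_add_collitonPairing_eq_zero`** —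
  `⟨M, ∇Ψ⟩ = 0`: for jointly `C¹` `ψ₀, ψ` with `Ψ(a, ·) = Ψ(b, ·) = 0`,
  `∫_a^b stMomentumStreaming ψ₀ ψ t (γ t) dt + collitonPairing ε ψ γ a b = 0`.

Torus geometry `Torus.geometry d` throughout (`ε < 1/2` is not needed for these identities: the
contact segment is the minimal-image one by definition of `sepVec`). Not here: `M` as a
matrix-valued measure, its positivity and trace mass ((16)–(17) of Serre 2024), determinantal
masses.

## References

* D. Serre, *Compensated integrability on tori; a priori estimate for space-periodic gas flows*,
  C. R. Math. Acad. Sci. Paris 362 (2024) 1425–1444, §5 p. 1438. [Serre2024]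
* D. Serre, *Hard spheres dynamics: weak vs strong collisions*, ARMA 240 (2021) 243–264, §2. [Serre2021]
-/

open Set Filter Function MeasureTheory
open scoped InnerProductSpace Topology

namespace Literature.Analysis.FluidPDE

noncomputable section

open Literature.Analysis.FunctionSpaces

section Segment

variable {d : Type*} [Fintype d] {F : Type*} [NormedAddCommGroup F] [NormedSpace ℝ F]
  [CompleteSpace F]

/-- **FTC along a straight segment on the torus**: for a `C¹` function `f : T^d → F`,
`f (x + proj w) - f x = ∫₀¹ D f (x + proj (s • w)) w ds`. [folklore] -/
theorem Torus.sub_eq_integral_fderiv {f : UnitAddTorus d → F} (hf : Torus.IsContDiff 1 f)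
    (x : UnitAddTorus d) (w : EuclideanSpace ℝ d) :
    f (x + Torus.proj w) - f x =
      ∫ s in (0 : ℝ)..1, Torus.fderiv f (x + Torus.proj (s • w)) w := by
  have hderiv : ∀ s : ℝ, HasDerivAt (fun σ : ℝ => f (x + Torus.proj (σ • w)))
      (Torus.fderiv f (x + Torus.proj (s • w)) w) s :=
    fun s => Torus.hasDerivAt_apply_add_proj_smul hf x w s
  have hpath : Continuous fun s : ℝ => x + Torus.proj (s • w) :=
    continuous_const.add (Torus.continuous_proj.comp (continuous_id.smul continuous_const))
  have hcont : Continuous fun s : ℝ => Torus.fderiv f (x + Torus.proj (s • w)) w :=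
    ((Torus.continuous_fderiv hf).comp hpath).clm_apply continuous_const
  rw [intervalIntegral.integral_eq_sub_of_hasDerivAt (fun s _ => hderiv s)
    (hcont.intervalIntegrable 0 1)]
  simp [Torus.proj_zero]

end Segment

/-! ## Collitons -/

section Colliton

variable {d : Type*} [Fintype d] {N : ℕ}

/-- **Serre's colliton of the ordered pair `(i, j)` tested against `∇φ`**: with
`Δv_i = v_i⁺ - v_i⁻` the momentum exchanged and `n_{ij}` the (minimal-image) separation vector of
the centres, `½ (ε / |Δv_i|) ∫₀¹ ⟪Dφ(x_j + proj(s n_{ij})) Δv_i, Δv_i⟫ ds` — the tensor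
`Δv_i ⊗ Δv_i / |Δv_i|` integrated with arc length (`dℓ = ε ds`) over the contact segment
`[x_j, x_i]` against `Dφ`, halved because both orientations of a colliding pair are summed
(`collidingPairs`). Junk (`0`-ish) off collisions. [cite: Serre2024, §5 p. 1438] -/
def collitonKernel (ε : ℝ) (φ : UnitAddTorus d → EuclideanSpace ℝ d) (i j : Fin N)
    (pre post : Config N d (UnitAddTorus d)) : ℝ :=
  2⁻¹ * (ε / ‖(post i).2 - (pre i).2‖) *
    ∫ s in (0 : ℝ)..1,
      ⟪Torus.fderiv φ ((post j).1 +
          Torus.proj (s • (Torus.geometry d).sepVec (post i).1 (post j).1))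
        ((post i).2 - (pre i).2), (post i).2 - (pre i).2⟫_ℝ

/-- The **colliton pairing** of a curve `γ` over the window `(a, b]` with a time-dependent test
field `ψ`: the sum over the collision times `τ ∈ (a, b]` and the colliding ordered pairs of
`collitonKernel ε (ψ τ)` (pre-collisional left limit, post-collisional value) — the colliton part
of Serre's tensor `M` paired with `∇_y ψ`. A `finsum` (finite on hard-sphere trajectories).
[cite: Serre2024, §5 p. 1438] -/
def collitonPairing (ε : ℝ) (ψ : ℝ → UnitAddTorus d → EuclideanSpace ℝ d)
    (γ : ℝ → Config N d (UnitAddTorus d)) (a b : ℝ) : ℝ :=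
  ∑ᶠ t ∈ collisionTimes (Torus.geometry d) ε γ ∩ Ioc a b,
    ∑ p ∈ collidingPairs (Torus.geometry d) ε (γ t), collitonKernel ε (ψ t) p.1 p.2 (leftLim γ t) (γ t)

/-- Each translation of the torus geometry is continuous. [folklore] -/
private theorem torus_continuous_translate'' (x : UnitAddTorus d) :
    Continuous ((Torus.geometry d).translate x) :=
  continuous_const.add Torus.continuous_proj

/-- Contact is symmetric in the pair on the torus (the minimal-image distance is symmetric).
[folklore] -/
theorem Torus.mem_contactSet_comm {ε : ℝ} {i j : Fin N} {z : Config N d (UnitAddTorus d)} :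
    z ∈ contactSet (Torus.geometry d) N ε i j ↔ z ∈ contactSet (Torus.geometry d) N ε j i := by
  simp only [mem_contactSet, Torus.norm_geometry_sepVec, Torus.euclidDist_comm (z i).1]

namespace IsHardSphereTrajectory

variable {ε : ℝ} {γ : ℝ → Config N d (UnitAddTorus d)}

/-- **A colliton compensates half a jump.** At a collision time of the pair `(i, j)` and for a
`C¹` field `φ`, `collitonKernel ε φ i j (γ τ⁻) (γ τ) = ½ ⟪φ(x_i) - φ(x_j), Δv_i⟫`: the segment
`s ↦ x_j + proj(s n_{ij})` runs from `x_j` to `x_i` (`proj n_{ij} = x_i - x_j`), so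
`φ(x_i) - φ(x_j) = ∫₀¹ Dφ n_{ij} ds` (FTC), and `Δv_i = c n_{ij}` with `c = |Δv_i| / ε > 0`
(elastic reflection of an incoming pair), whence `⟪Dφ n, Δv_i⟫ = (ε/|Δv_i|) ⟪Dφ Δv_i, Δv_i⟫`.
[cite: Serre2024, §5 p. 1438] -/
theorem collitonKernel_eq (h : IsHardSphereTrajectory (Torus.geometry d) ε N γ)
    {φ : UnitAddTorus d → EuclideanSpace ℝ d} (hφ : Torus.IsContDiff 1 φ) {t : ℝ} {i j : Fin N}
    (hij : i ≠ j) (hc : γ t ∈ contactSet (Torus.geometry d) N ε i j) :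
    collitonKernel ε φ i j (leftLim γ t) (γ t) =
      2⁻¹ * ⟪φ (γ t i).1 - φ (γ t j).1, (γ t i).2 - (leftLim γ t i).2⟫_ℝ := by
  set n : EuclideanSpace ℝ d := (Torus.geometry d).sepVec (γ t i).1 (γ t j).1 with hn
  set Δv : EuclideanSpace ℝ d := (γ t i).2 - (leftLim γ t i).2 with hΔv
  set c : ℝ := -(⟪(leftLim γ t i).2 - (leftLim γ t j).2, n⟫_ℝ / ‖n‖ ^ 2) with hcdef
  have hnorm : ‖n‖ = ε := (mem_contactSet.1 hc).2
  have hΔvc : Δv = c • n := by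
    rw [hΔv, hcdef, h.vel_sub_leftLim_eq_smul torus_continuous_translate'' hij hc, ← hn, neg_smul]
  have hinner_pos : 0 < ⟪n, Δv⟫_ℝ := h.inner_sepVec_vel_sub_leftLim_pos torus_continuous_translate'' hij hc
  have hn0 : n ≠ 0 := fun h0 => by
    rw [h0, inner_zero_left] at hinner_pos
    exact lt_irrefl _ hinner_pos
  have hnpos : 0 < ‖n‖ := norm_pos_iff.2 hn0
  have hcpos : 0 < c := by
    rw [hΔvc, real_inner_smul_right, real_inner_self_eq_norm_sq] at hinner_pos
    exact pos_of_mul_pos_left hinner_pos (sq_nonneg _)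
  have hΔvnorm : ‖Δv‖ = c * ε := by
    rw [hΔvc, norm_smul, Real.norm_eq_abs, abs_of_pos hcpos, hnorm]
  have hεpos : 0 < ε := hnorm ▸ hnpos
  -- endpoint of the segment
  have hend : (γ t j).1 + Torus.proj n = (γ t i).1 := by
    rw [hn, Torus.geometry_sepVec, Torus.proj_reprSym, add_sub_cancel]
  -- FTC along the segment, paired with `Δv`
  have hftc := Torus.sub_eq_integral_fderiv hφ (γ t j).1 n
  rw [hend] at hftc
  have hpath : Continuous fun s : ℝ => (γ t j).1 + Torus.proj (s • n) :=
    continuous_const.add (Torus.continuous_proj.comp (continuous_id.smul continuous_const))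
  have hint : IntervalIntegrable
      (fun s : ℝ => Torus.fderiv φ ((γ t j).1 + Torus.proj (s • n)) n) volume 0 1 :=
    (((Torus.continuous_fderiv hφ).comp hpath).clm_apply continuous_const).intervalIntegrable 0 1
  have hpair : ⟪φ (γ t i).1 - φ (γ t j).1, Δv⟫_ℝ =
      ∫ s in (0 : ℝ)..1, ⟪Torus.fderiv φ ((γ t j).1 + Torus.proj (s • n)) n, Δv⟫_ℝ := by
    rw [hftc, real_inner_comm, ← innerSL_apply_apply (𝕜 := ℝ),
      ← ContinuousLinearMap.intervalIntegral_comp_comm _ hint]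
    refine intervalIntegral.integral_congr fun s _ => ?_
    simp only [innerSL_apply_apply, real_inner_comm]
  -- `⟪D n, Δv⟫ = (ε/|Δv|) ⟪D Δv, Δv⟫`
  have hpt : ∀ s : ℝ,
      ⟪Torus.fderiv φ ((γ t j).1 + Torus.proj (s • n)) n, Δv⟫_ℝ =
        ε / ‖Δv‖ * ⟪Torus.fderiv φ ((γ t j).1 + Torus.proj (s • n)) Δv, Δv⟫_ℝ := by
    intro s
    have hc0 : c ≠ 0 := hcpos.ne'
    have hε0 : ε ≠ 0 := hεpos.ne'
    rw [hΔvnorm, hΔvc, ContinuousLinearMap.map_smul, real_inner_smul_left, real_inner_smul_right]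
    field_simp
  simp_rw [hpt] at hpair
  rw [intervalIntegral.integral_const_mul] at hpair
  rw [collitonKernel, ← hΔv, ← hn, hpair, mul_assoc]

/-- **The two collitons of a collision compensate the jump**: summed over the colliding ordered
pairs `{(i, j), (j, i)}` at a collision time, the colliton kernels of a `C¹` field `φ` give the
collisional jump of the momentum observable, `⟪φ(x_i) - φ(x_j), Δv_i⟫`
(`Δv_j = -Δv_i`, so both orientations contribute the same half). [cite: Serre2024, §5 p. 1438] -/
theorem sum_collidingPairs_collitonKernel (h : IsHardSphereTrajectory (Torus.geometry d) ε N γ)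
    {φ : UnitAddTorus d → EuclideanSpace ℝ d} (hφ : Torus.IsContDiff 1 φ) {t : ℝ} {i j : Fin N}
    (hij : i ≠ j) (hc : γ t ∈ contactSet (Torus.geometry d) N ε i j) :
    ∑ p ∈ collidingPairs (Torus.geometry d) ε (γ t), collitonKernel ε φ p.1 p.2 (leftLim γ t) (γ t) =
      collisionJump (momentumObservable φ) γ t := by
  have hc' : γ t ∈ contactSet (Torus.geometry d) N ε j i := Torus.mem_contactSet_comm.1 hc
  rw [h.sum_collidingPairs_eq hij hc, h.collitonKernel_eq hφ hij hc, h.collitonKernel_eq hφ hij.symm hc',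
    h.vel_sub_leftLim_right_eq_neg hij hc,
    h.collisionJump_momentumObservable torus_continuous_translate'' φ hij hc, inner_neg_right,
    ← neg_sub (φ (γ t i).1), inner_neg_left, neg_neg]
  ring

/-- On a hard-sphere trajectory the colliton pairing of a field with `C¹` frozen slices is the
collisional transfer of the frozen momentum observables. [cite: Serre2024, §5 p. 1438] -/
theorem collitonPairing_eq_finsum_collisionJump (h : IsHardSphereTrajectory (Torus.geometry d) ε N γ)
    {ψ : ℝ → UnitAddTorus d → EuclideanSpace ℝ d} (hψ : ∀ t, Torus.IsContDiff 1 (ψ t)) (a b : ℝ) :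
    collitonPairing ε ψ γ a b =
      ∑ᶠ t ∈ collisionTimes (Torus.geometry d) ε γ ∩ Ioc a b,
        collisionJump (momentumObservable (ψ t)) γ t := by
  refine finsum_mem_congr rfl fun t ht => ?_
  obtain ⟨i, j, hij, hc⟩ := ht.1
  exact h.sum_collidingPairs_collitonKernel (hψ t) hij hc

/-- A jointly `C¹` space–time field has `C¹` frozen slices. [folklore] -/
theorem _root_.Literature.Analysis.FluidPDE.Torus.isContDiff_slice_of_stLift
    {F : Type*} [NormedAddCommGroup F] [NormedSpace ℝ F] {ψ : ℝ → UnitAddTorus d → F}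
    {n : WithTop ℕ∞} (hψ : ContDiff ℝ n (Torus.stLift ψ)) (t : ℝ) : Torus.IsContDiff n (ψ t) := by
  change ContDiff ℝ n (Torus.stLift ψ ∘ fun y : EuclideanSpace ℝ d => (t, y))
  exact hψ.comp (contDiff_prodMk_right t)

/-- **`Div M = 0`, tested (Serre 2024 §5).** Along a hard-sphere trajectory on `T^d`, for jointly
`C¹` test fields `ψ₀ : ℝ → T^d → ℝ`, `ψ : ℝ → T^d → ℝ^d` vanishing at the ends of the window
(`Ψ(a, ·) = Ψ(b, ·) = 0`), the mass–momentum tensor with collitons paired with `∇_{t,y} Ψ`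
vanishes: `∫_a^b Σ_i (Dψ₀ (1, v_i) + ⟪Dψ (1, v_i), v_i⟫)(t, x_i(t)) dt + collitonPairing ε ψ γ a b = 0`
— the particle part contributes `-Σ_coll ⟪ψ(τ, x_i) - ψ(τ, x_j), [v_i]⟫`
(`integral_stMomentumStreaming_eq_neg_finsum`) and the collitons `+` the same
(`collitonPairing_eq_finsum_collisionJump`). [cite: Serre2024, §5 p. 1438] -/
theorem integral_stMomentumStreaming_add_collitonPairing_eq_zero
    (h : IsHardSphereTrajectory (Torus.geometry d) ε N γ) {ψ₀ : ℝ → UnitAddTorus d → ℝ}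
    {ψ : ℝ → UnitAddTorus d → EuclideanSpace ℝ d} (hψ₀ : ContDiff ℝ 1 (Torus.stLift ψ₀))
    (hψ : ContDiff ℝ 1 (Torus.stLift ψ)) {a b : ℝ} (hab : a ≤ b) (ha₀ : ψ₀ a = 0) (hb₀ : ψ₀ b = 0)
    (ha : ψ a = 0) (hb : ψ b = 0) :
    (∫ s in a..b, stMomentumStreaming ψ₀ ψ s (γ s)) + collitonPairing ε ψ γ a b = 0 := by
  rw [h.integral_stMomentumStreaming_eq_neg_finsum hψ₀ hψ hab ha₀ hb₀ ha hb,
    h.collitonPairing_eq_finsum_collisionJump (fun t => Torus.isContDiff_slice_of_stLift hψ t) a b,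
    neg_add_cancel]

/-- **`Div M` = boundary terms, tested.** Without the vanishing condition at the ends of the
window, the pairing of the tensor with `∇_{t,y} Ψ` is the difference of the space–time momentum
observable at `b` and `a`: `Div M` (extended by zero outside `(a, b)`) is carried by the two time
slices, with density `Σ_p (1, v_p) δ_{x_p}` (Serre 2024 §5 (16): "the restriction of its first
column to the initial and final hyperplanes"). [cite: Serre2024, §5 (16)] -/
theorem integral_stMomentumStreaming_add_collitonPairing_eq_sub
    (h : IsHardSphereTrajectory (Torus.geometry d) ε N γ) {ψ₀ : ℝ → UnitAddTorus d → ℝ}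
    {ψ : ℝ → UnitAddTorus d → EuclideanSpace ℝ d} (hψ₀ : ContDiff ℝ 1 (Torus.stLift ψ₀))
    (hψ : ContDiff ℝ 1 (Torus.stLift ψ)) {a b : ℝ} (hab : a ≤ b) :
    (∫ s in a..b, stMomentumStreaming ψ₀ ψ s (γ s)) + collitonPairing ε ψ γ a b =
      stMomentumObservable ψ₀ ψ b (γ b) - stMomentumObservable ψ₀ ψ a (γ a) := by
  rw [(h.stMomentumObservable_sub_eq hψ₀ hψ hab).2,
    h.collitonPairing_eq_finsum_collisionJump (fun t => Torus.isContDiff_slice_of_stLift hψ t) a b]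

end IsHardSphereTrajectory

/-- **Mass of the boundary term** (Serre 2024 §5 (16), `‖Div S‖ ≤ N + 2√(NE) + …`): the
space–time momentum observable is bounded by `C₀ N + C₁ √N √(2E)` when `|ψ₀ t x| ≤ C₀` and
`‖ψ t x‖ ≤ C₁` (Cauchy–Schwarz `Σ_p |v_p| ≤ √N √(Σ_p |v_p|²)`, `Σ_p |v_p|² = 2E`).
[cite: Serre2024, §5 (16)] -/
theorem abs_stMomentumObservable_le {ψ₀ : ℝ → UnitAddTorus d → ℝ}
    {ψ : ℝ → UnitAddTorus d → EuclideanSpace ℝ d} {C₀ C₁ : ℝ} {t : ℝ}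
    (h₀ : ∀ x, |ψ₀ t x| ≤ C₀) (h₁ : ∀ x, ‖ψ t x‖ ≤ C₁) (z : Config N d (UnitAddTorus d)) :
    |stMomentumObservable ψ₀ ψ t z| ≤
      C₀ * N + C₁ * (Real.sqrt N * Real.sqrt (2 * configEnergy z)) := by
  have hC₁ : 0 ≤ C₁ := (norm_nonneg _).trans (h₁ (0 : UnitAddTorus d))
  have hterm : ∀ i : Fin N, |ψ₀ t (z i).1 + ⟪ψ t (z i).1, (z i).2⟫_ℝ| ≤ C₀ + C₁ * ‖(z i).2‖ := by
    intro i
    refine (abs_add_le _ _).trans (add_le_add (h₀ _) ?_)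
    exact (abs_real_inner_le_norm _ _).trans (mul_le_mul_of_nonneg_right (h₁ _) (norm_nonneg _))
  have hsum : |stMomentumObservable ψ₀ ψ t z| ≤ ∑ i : Fin N, (C₀ + C₁ * ‖(z i).2‖) :=
    (Finset.abs_sum_le_sum_abs _ _).trans (Finset.sum_le_sum fun i _ => hterm i)
  have hcs : ∑ i : Fin N, ‖(z i).2‖ ≤ Real.sqrt N * Real.sqrt (2 * configEnergy z) := by
    have h := Real.sum_mul_le_sqrt_mul_sqrt (Finset.univ : Finset (Fin N)) (fun _ => (1 : ℝ))
      fun i => ‖(z i).2‖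
    have hE : ∑ i : Fin N, ‖(z i).2‖ ^ 2 = 2 * configEnergy z := by
      simp only [configEnergy]
      ring
    simpa [hE] using h
  calc |stMomentumObservable ψ₀ ψ t z| ≤ ∑ i : Fin N, (C₀ + C₁ * ‖(z i).2‖) := hsum
    _ = C₀ * N + C₁ * ∑ i : Fin N, ‖(z i).2‖ := by
        rw [Finset.sum_add_distrib, Finset.sum_const, Finset.card_univ, Fintype.card_fin,
          nsmul_eq_mul, ← Finset.mul_sum]
        ring
    _ ≤ C₀ * N + C₁ * (Real.sqrt N * Real.sqrt (2 * configEnergy z)) := by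
        gcongr

end Colliton

end

end Literature.Analysis.FluidPDE
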